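import Literature.NumberTheory.EllipticCurves.ZpExtensionEisensteinAdicTowerSMulProofs
import Literature.NumberTheory.EllipticCurves.ZpExtensionEisensteinSelmerStructureProofs
import Literature.NumberTheory.EllipticCurves.IwasawaAlgebraEisensteinRankOneCokernelProofs
import Literature.NumberTheory.EllipticCurves.IwasawaAlgebraSpecializationTorsionBoundProofs
import HarnessLib

/-!
# The PINNED `H¹_{F_𝔮}(K, T_𝔮)` as the honest `S_m`-module of Howard's Theorem 1.6.1 (a) on the SHIFTED Eisenstein
# tower: the glue `ι = (proj_{k+1})_k`, its range `lim_k H¹_{F_𝔮}(K, T_𝔮/p^{k+1})`, and the COKERNEL bound of a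
# control map from ONE non-divisible value (proofs file)

Topic `NumberTheory/EllipticCurves`. THEOREMS ONLY (no definition, no named fact, no instance, no notation, no
`sorry`), in the vocabulary of the tree: the pin `ZpExtension.EisensteinH1Data κ ρ t hm` of Howard's
`H¹(K, T_𝔮) = lim_k H¹(K, T_𝔮/p^k T_𝔮)` at `𝔮 = (T^m + p)` (`ZpExtensionEisensteinH1Data`), its Selmer part
`EisensteinH1Data.ordinarySelmer = (selmerSubmodule F_𝔮 _).toAddSubgroup` (`ZpExtensionEisensteinSelmerStructure{,Proofs}`),
the typed π-adic towers of B. Howard, Compositio Math. 140 (2004) §1.6 (`Howard2004.AdicTower`, `limitSelmer`,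
`smulFamily`, `IsFreeRankOneOn` of `GaloisCohomology/Howard2004/{SelmerTriples,DVRKolyvaginBound}`) instantiated at
the SHIFTED Eisenstein tower `κ.eisensteinAdicTowerSucc ρ t hm ht` (`k ↦ T_𝔮/p^{k+1} T_𝔮`, the `T` of the D1
assembly `WeierstrassCurve.eisensteinDVRSetting`, `ZpExtensionEisensteinAdicTower`), and the rank-one index lemma
`IwasawaAlgebra.finite_quotient_range_and_natCard_le_of_not_mem_X_pow_smul` (`IwasawaAlgebraEisensteinRankOneCokernelProofs`).

WHAT (cell `pub/bsd-print-x9`, seat `bsd-line-x10b-p1-w2` g9; the COMPACT half of `stub_controlGlue` of the shared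
μ-crux `MuInequalityCoherentPair`, skeleton `Cruxes/MuInequalityCoherentPair/Lines/spec_witnesses.lean`, whose
composition socket `HeegnerMuPartStabilized.nonempty_specWitness_of_dvrConclusion_one` (p653022) asks, on the compact
side, for an honest `S_m`-module `H` with `[IsScalarTower Λ S_m H]`, an additive injection
`ι : H →+ Π_k H¹(K, T^{(k)})` with `range ι = St.T.limitSelmer (k ↦ (St.t k).cond)` and `ι (r • y) = smulFamily r (ι y)`,
a `Λ`-linear `f : 𝔖 → H`, and `Finite (H ⧸ range f)`, `Nat.card (H ⧸ range f) ≤ c`). For ANY pin `I` and ANY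
`S_m`-structure compatible with `Λ`:
* §1 `EisensteinH1Data.isTorsionBy_qm{,_submodule}` — `I.H` and its `Λ`-submodules are `q_m`-torsion, so Mathlib's
  `Module.IsTorsionBy.module` IS an honest `S_m`-module structure, with `isScalarTower_qm_submodule`; under any
  compatible structure `[g] • y = g • y` (`mk_smul_eq_smul`).
* §2 the glue `ι := AddMonoidHom.pi (k ↦ I.proj (k+1))` (level `k` of the shifted tower = torsion level `k+1`):
  `injective_projSucc` (level `0` is the reduction of level `1`), **`projSucc_smul`** (`ι (r • y) = T♯.smulFamily r (ι y)`,
  by `proj_smul` and `smulFamily_eisensteinAdicTowerSucc_mk`).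
* §3 `map_eisensteinTwistReduce_mem_selmerGroup` (GLOBAL compatibility of `F_𝔮` along the reductions, from the local
  `eisensteinLocalReduce_mem_eisensteinSelmerStructure` and `localization_map_eisensteinTwistReduce`),
  `projSucc_mem_limitSelmer_of_mem_ordinarySelmer`, and **`mem_limitSelmer_succ_iff_mem_range`**:
  `y ∈ T♯.limitSelmer (k ↦ F_𝔮 at level k+1) ↔ y ∈ range (ι ∘ subtype)` for `H := I.selmerSubmodule F_𝔮 _` — extend a
  typed family to level `0` by reduction and lift it by `EisensteinH1Data.surj`.
* §4 (pure algebra, `IwasawaAlgebra.…`) `exists_bijective_toSpanSingleton_of_isFreeRankOneOn` (Thm. 1.6.1 (a) through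
  the glue gives an honest free generator `x₀`, the bookkeeping of p643969 exported);
  **`finite_quotient_range_codRestrict_and_natCard_le`** — for `N ≤ H'` free of rank one over the DVR `S_m`, a
  `Λ`-linear `f : 𝔖 → H'` landing in `N` and `e` with `f e ∉ T^j • H'` (`j < m`): the cokernel of the co-restriction
  `f̂ : 𝔖 → N` is finite of order `≤ p^j` (`hcoker`, `hcoker_le`); `apply_ne_zero_of_smul_mem_span` — then `f z ≠ 0`
  whenever `g • e ∈ Λ z` with `[g] ≠ 0 ∈ S_m` (`hone`); `exists_forall_mk_ne_zero` — `[g]_m ≠ 0` for all `m ≫ 0`.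
With the tree's `PrintX10bModPDivision.exists_forall_toEisensteinH1Linear_not_mem_X_pow_smul_top` (ONE `e ∈ 𝔖` and
ONE `n₁` with `f_m e ∉ T^{p^{n₁}} • H¹(K, T_{𝔮_m})` for every `m ≥ p^{n₁}`) these give the m-UNIFORM compact-side
inputs of the socket for Howard's control map `f_m = toEisensteinH1Linear` [Howard 2004, Prop. 2.2.8 and proof of
Thm. 2.2.10; Mazur–Rubin 2004, Prop. 5.3.14] WITHOUT Poitou–Tate duality and without any local index — the
specialisation to the curve is the Summits-side companion `Theorems/PrintX10bControlCompactGlue`. HONEST FRAMING: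
glue and commutative algebra; no control theorem with kernel bounds, no Kolyvagin system and no statement about
`L`-functions is proved here; BSD is not proved by any of this; no summit statement is proved by this seat.

References: [Howard2004HeegnerKolyvagin] B. Howard, *The Heegner point Kolyvagin system*, Compositio Math. 140
(2004) 1439–1472 = arXiv:1202.6340: §1.6 (p. 12, L29–55: `H¹_F(K,T) = lim_k H¹_F(K, T/𝔪^k T)` as an `R`-module),
Thm. 1.6.1 (a), §2.2 Def. 2.2.3, Lemma 2.2.7, Prop. 2.2.8, proof of Thm. 2.2.10 («taking `𝔮 = T^m + p`»), Def. 3.1.2,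
Prop. 3.1.3; [MazurRubinMemoirs2004] B. Mazur, K. Rubin, *Kolyvagin systems*, Mem. AMS 799 (2004), §5.3,
Prop. 5.3.14; [Washington1997] §13.2 (Λ is a UFD; `Λ/(p, T^j)`); [SerreGaloisCohomology1997] I §2.2, §2.4, II §1;
[AtiyahMacdonald1969] Ch. 2.
-/

set_option autoImplicit false

noncomputable section

open scoped TensorProduct ContRepresentation Classical
open Field IsLocalRing IsDedekindDomain

namespace Literature.NumberTheory.EllipticCurves

open Literature.NumberTheory.GaloisRepresentations
open Literature.NumberTheory.GaloisCohomology.Howard2004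
open scoped NumberField

namespace ZpExtension

namespace EisensteinH1Data

/-! ## §1 The pinned `H¹(K, T_𝔮)` is killed by `q_m`: it is an honest `S_m = Λ/(q_m)`-module -/

section Torsion

variable {K : Type} [Field K] {p : ℕ} [hp : Fact p.Prime] {κ : ZpExtension K p}
  {M : ℕ → Type} [∀ k, AddCommGroup (M k)] [∀ k, TopologicalSpace (M k)] [∀ k, DiscreteTopology (M k)]
  {ρ : ∀ k, DiscreteGaloisModule K (M k)}
  {t : ∀ k, (ρ (k + 1)).toContRepresentation →ⁱL (ρ k).toContRepresentation} {m : ℕ} {hm : 1 ≤ m}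
  (I : EisensteinH1Data κ ρ t hm)

/-- `q_m • h = 0` on the pinned `H¹(K, T_𝔮)`. [cite: Howard2004HeegnerKolyvagin, §2.2 and Def. 2.2.3 (H¹(K, T_𝔮) is an S_𝔮-module)] -/
theorem qm_smul_eq_zero (h : I.H) :
    (PowerSeries.X ^ m + PowerSeries.C (p : ℤ_[p]) : IwasawaAlgebra p) • h = 0 := by
  rw [← zero_smul (IwasawaAlgebra p) h]
  exact I.smul_eq_smul_of_sub_mem_span_qm (by rw [sub_zero]; exact Ideal.mem_span_singleton_self _) h

/-- **The pinned `H¹(K, T_𝔮)` is `q_m`-torsion** (so Mathlib's `Module.IsTorsionBy.module` makes it an honest module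
over `S_m = Λ/(q_m)`, compatible with the `Λ`-action). [cite: Howard2004HeegnerKolyvagin, §2.2 and Def. 2.2.3] -/
theorem isTorsionBy_qm :
    Module.IsTorsionBy (IwasawaAlgebra p) I.H (PowerSeries.X ^ m + PowerSeries.C (p : ℤ_[p]) : IwasawaAlgebra p) :=
  fun h ↦ I.qm_smul_eq_zero h

/-- Every `Λ`-submodule of the pinned `H¹(K, T_𝔮)` (e.g. `H¹_{F_𝔮}(K, T_𝔮)`) is `q_m`-torsion.
[cite: Howard2004HeegnerKolyvagin, §2.2 and Prop. 3.1.3 (H¹_{F_𝔮}(K, T_𝔮) is an S_𝔮-module)] -/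
theorem isTorsionBy_qm_submodule (N : Submodule (IwasawaAlgebra p) I.H) :
    Module.IsTorsionBy (IwasawaAlgebra p) N (PowerSeries.X ^ m + PowerSeries.C (p : ℤ_[p]) : IwasawaAlgebra p) :=
  fun y ↦ Subtype.ext (by
    rw [Submodule.coe_smul, Submodule.coe_zero]
    exact I.qm_smul_eq_zero (y : I.H))

/-- The `S_m`-module structure `Module.IsTorsionBy.module` on a `Λ`-submodule of the pinned `H¹(K, T_𝔮)` is
compatible with the `Λ`-action (`IsScalarTower Λ S_m N`). [cite: Howard2004HeegnerKolyvagin, §2.2 and Prop. 3.1.3] -/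
theorem isScalarTower_qm_submodule (N : Submodule (IwasawaAlgebra p) I.H) :
    letI := (I.isTorsionBy_qm_submodule N).module
    IsScalarTower (IwasawaAlgebra p) (IwasawaAlgebra p ⧸
      Ideal.span {(PowerSeries.X ^ m + PowerSeries.C (p : ℤ_[p]) : IwasawaAlgebra p)}) N := by
  letI := (I.isTorsionBy_qm_submodule N).module
  exact Module.IsTorsionBySet.isScalarTower _

/-- Under ANY `S_m`-module structure on a `Λ`-submodule `N` of the pinned `H¹(K, T_𝔮)` compatible with the
`Λ`-action, the class `[g]` of `g ∈ Λ` acts as `g`. [cite: Howard2004HeegnerKolyvagin, §2.2] -/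
theorem mk_smul_eq_smul (N : Submodule (IwasawaAlgebra p) I.H)
    [Module (IwasawaAlgebra p ⧸
      Ideal.span {(PowerSeries.X ^ m + PowerSeries.C (p : ℤ_[p]) : IwasawaAlgebra p)}) N]
    [IsScalarTower (IwasawaAlgebra p) (IwasawaAlgebra p ⧸
      Ideal.span {(PowerSeries.X ^ m + PowerSeries.C (p : ℤ_[p]) : IwasawaAlgebra p)}) N]
    (g : IwasawaAlgebra p) (y : N) :
    (Ideal.Quotient.mk
      (Ideal.span {(PowerSeries.X ^ m + PowerSeries.C (p : ℤ_[p]) : IwasawaAlgebra p)}) g) • y = g • y :=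
  (IwasawaAlgebra.smul_eq_mk_smul p g y).symm

end Torsion

/-! ## §2 The glue `ι : h ↦ (proj_{k+1} h)_k` into the families over the shifted tower `k ↦ T_𝔮/p^{k+1}` -/

section Glue

variable {K : Type} [Field K] {p : ℕ} [hp : Fact p.Prime] {κ : ZpExtension K p}
  {M : ℕ → Type} [∀ k, AddCommGroup (M k)] [∀ k, TopologicalSpace (M k)] [∀ k, DiscreteTopology (M k)]
  {ρ : ∀ k, DiscreteGaloisModule K (M k)}
  {t : ∀ k, (ρ (k + 1)).toContRepresentation →ⁱL (ρ k).toContRepresentation} {m : ℕ} {hm : 1 ≤ m}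
  (I : EisensteinH1Data κ ρ t hm) (ht : ∀ k, Function.Surjective (t k))

/-- The family of the projections from torsion level `1` on, as an additive map into the families over the shifted
tower `κ.eisensteinAdicTowerSucc ρ t hm ht` (level `k` = torsion level `k+1`): `h ↦ (I.proj (k+1) h)_k`.
[cite: Howard2004HeegnerKolyvagin, §1.6 (arXiv p. 12, L29–55) and §2.2] -/
theorem projSucc_apply (h : I.H) (k : ℕ) :
    letI := IwasawaAlgebra.isLocalRing_quotient_X_pow_add_C p hm
    (AddMonoidHom.pi (fun k ↦ I.proj (k + 1)) :
        I.H →+ ∀ k, galoisCohomology ((κ.eisensteinAdicTowerSucc ρ t hm ht).ρ k) 1) h k = I.proj (k + 1) h :=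
  rfl

/-- The projections from level `1` on already determine an element of the pinned `H¹(K, T_𝔮)` (level `0` is the
reduction of level `1`): **`ι` is injective** on `H¹(K, T_𝔮)`. [cite: Howard2004HeegnerKolyvagin, §2.2 (T_𝔮 = lim T_𝔮/p^k T_𝔮)] -/
theorem injective_projSucc :
    letI := IwasawaAlgebra.isLocalRing_quotient_X_pow_add_C p hm
    Function.Injective (AddMonoidHom.pi (fun k ↦ I.proj (k + 1)) :
        I.H →+ ∀ k, galoisCohomology ((κ.eisensteinAdicTowerSucc ρ t hm ht).ρ k) 1) := by
  letI := IwasawaAlgebra.isLocalRing_quotient_X_pow_add_C p hm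
  rw [injective_iff_map_eq_zero]
  intro h hh
  refine I.ext h fun k ↦ ?_
  cases k with
  | zero => rw [← I.proj_reduce 0 h, show I.proj (0 + 1) h = 0 from congrFun hh 0, map_zero]
  | succ k => exact congrFun hh k


/-- **`ι` intertwines the honest `S_m`-action with part B's `smulFamily`**: for a `Λ`-submodule `N` of the pinned
`H¹(K, T_𝔮)` with any compatible `S_m`-module structure, `ι (r • y) = T♯.smulFamily r (ι y)` on the shifted tower
`T♯ = κ.eisensteinAdicTowerSucc ρ t hm ht` — the clause `hι_smul` of `nonempty_specWitness_of_dvrConclusion`.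
[cite: Howard2004HeegnerKolyvagin, §1.6 (arXiv p. 12, L29–55: H¹_F(K,T) as an R-module through the tower) and §2.2, Def. 2.2.3] -/
theorem projSucc_smul (N : Submodule (IwasawaAlgebra p) I.H)
    [Module (IwasawaAlgebra p ⧸
      Ideal.span {(PowerSeries.X ^ m + PowerSeries.C (p : ℤ_[p]) : IwasawaAlgebra p)}) N]
    [IsScalarTower (IwasawaAlgebra p) (IwasawaAlgebra p ⧸
      Ideal.span {(PowerSeries.X ^ m + PowerSeries.C (p : ℤ_[p]) : IwasawaAlgebra p)}) N]
    (r : IwasawaAlgebra p ⧸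
      Ideal.span {(PowerSeries.X ^ m + PowerSeries.C (p : ℤ_[p]) : IwasawaAlgebra p)}) (y : N) :
    letI := IwasawaAlgebra.isLocalRing_quotient_X_pow_add_C p hm
    ((AddMonoidHom.pi (fun k ↦ I.proj (k + 1))).comp N.subtype.toAddMonoidHom :
        N →+ ∀ k, galoisCohomology ((κ.eisensteinAdicTowerSucc ρ t hm ht).ρ k) 1) (r • y) =
      (κ.eisensteinAdicTowerSucc ρ t hm ht).smulFamily r
        (((AddMonoidHom.pi (fun k ↦ I.proj (k + 1))).comp N.subtype.toAddMonoidHom :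
          N →+ ∀ k, galoisCohomology ((κ.eisensteinAdicTowerSucc ρ t hm ht).ρ k) 1) y) := by
  letI := IwasawaAlgebra.isLocalRing_quotient_X_pow_add_C p hm
  obtain ⟨g, rfl⟩ := Ideal.Quotient.mk_surjective r
  funext k
  rw [κ.smulFamily_eisensteinAdicTowerSucc_mk ρ t hm ht g]
  change I.proj (k + 1) (((Ideal.Quotient.mk _ g) • y : N) : I.H) = _
  rw [I.mk_smul_eq_smul N g y, Submodule.coe_smul, I.proj_smul]
  rfl

end Glue

end EisensteinH1Data

/-! ## §3 The range of `ι` on `H¹_{F_𝔮}(K, T_𝔮)` is `lim_k H¹_{F_𝔮}(K, T_𝔮/p^{k+1})` (typed `limitSelmer`) -/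

section SelmerRed

variable {K : Type} [Field K] [NumberField K] {p : ℕ} [hp : Fact p.Prime] (κ : ZpExtension K p)
  {M : ℕ → Type} [∀ k, AddCommGroup (M k)] [∀ k, TopologicalSpace (M k)] [∀ k, DiscreteTopology (M k)]
  (ρ : ∀ k, DiscreteGaloisModule K (M k))
  (t : ∀ k, (ρ (k + 1)).toContRepresentation →ⁱL (ρ k).toContRepresentation) {m : ℕ} (hm : 1 ≤ m)
  (S : Finset (HeightOneSpectrum (𝓞 K)))
  (Φ : ∀ v : HeightOneSpectrum (𝓞 K), ((p : ℕ) : 𝓞 K) ∈ v.asIdeal → OrdinaryFiltration ρ t v)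

/-- **Reduction preserves `F_𝔮`-Selmer classes (global form)**: `H¹(reduce_k)` maps `H¹_{F_𝔮}(K, T_𝔮/p^{k+1})` into
`H¹_{F_𝔮}(K, T_𝔮/p^k)` (localisation commutes with reduction, and `F_𝔮` is a compatible family place by place).
[cite: Howard2004HeegnerKolyvagin, §1.6 (arXiv p. 12: F on T seen on the levels T/𝔪^k T) and Def. 3.1.2] -/
theorem map_eisensteinTwistReduce_mem_selmerGroup (k : ℕ)
    {x : galoisCohomology (κ.eisensteinTwist (ρ (k + 1)) hm (k + 1)) 1}
    (hx : x ∈ (κ.eisensteinSelmerStructure ρ t hm S Φ (k + 1)).selmerGroup) :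
    galoisCohomology.map (κ.eisensteinTwistReduce hm (Nat.le_succ k) (t k)) 1 x ∈
      (κ.eisensteinSelmerStructure ρ t hm S Φ k).selmerGroup := by
  rw [DiscreteGaloisModule.SelmerStructure.mem_selmerGroup_iff] at hx ⊢
  intro v
  rw [κ.localization_map_eisensteinTwistReduce ρ t hm v k x]
  exact κ.eisensteinLocalReduce_mem_eisensteinSelmerStructure ρ t hm S Φ k v (hx v)

end SelmerRed

namespace EisensteinH1Data

section Selmer

variable {K : Type} [Field K] [NumberField K] {p : ℕ} [hp : Fact p.Prime] {κ : ZpExtension K p}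
  {M : ℕ → Type} [∀ k, AddCommGroup (M k)] [∀ k, TopologicalSpace (M k)] [∀ k, DiscreteTopology (M k)]
  {ρ : ∀ k, DiscreteGaloisModule K (M k)}
  {t : ∀ k, (ρ (k + 1)).toContRepresentation →ⁱL (ρ k).toContRepresentation} {m : ℕ} {hm : 1 ≤ m}
  (I : EisensteinH1Data κ ρ t hm) (ht : ∀ k, Function.Surjective (t k))
  (S : Finset (HeightOneSpectrum (𝓞 K)))
  (Φ : ∀ v : HeightOneSpectrum (𝓞 K), ((p : ℕ) : 𝓞 K) ∈ v.asIdeal → OrdinaryFiltration ρ t v)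


/-- **A pinned `F_𝔮`-Selmer element gives a typed one on the shifted tower**: for `h ∈ H¹_{F_𝔮}(K, T_𝔮)`
(`ordinarySelmer` = `selmerSubmodule F_𝔮 _` of the pin `I`) the family `(proj_{k+1} h)_k` lies in
`(κ.eisensteinAdicTowerSucc ρ t hm ht).limitSelmer (k ↦ F_𝔮 at level k+1)` — the clause `hone_mem` for a control image.
[cite: Howard2004HeegnerKolyvagin, §1.6 (arXiv p. 12, L29–55) and Def. 3.1.2] -/
theorem projSucc_mem_limitSelmer_of_mem_ordinarySelmer {h : I.H} (hh : h ∈ I.ordinarySelmer S Φ) :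
    letI := IwasawaAlgebra.isLocalRing_quotient_X_pow_add_C p hm
    (AddMonoidHom.pi (fun k ↦ I.proj (k + 1)) :
        I.H →+ ∀ k, galoisCohomology ((κ.eisensteinAdicTowerSucc ρ t hm ht).ρ k) 1) h ∈
      (κ.eisensteinAdicTowerSucc ρ t hm ht).limitSelmer
        (fun k ↦ κ.eisensteinSelmerStructure ρ t hm S Φ (k + 1)) := by
  letI := IwasawaAlgebra.isLocalRing_quotient_X_pow_add_C p hm
  rw [AdicTower.mem_limitSelmer_iff]
  refine ⟨fun k ↦ ?_, fun k ↦ (I.mem_ordinarySelmer_iff S Φ h).1 hh (k + 1)⟩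
  rw [κ.redH1_eisensteinAdicTowerSucc ρ t hm ht k]
  exact I.proj_reduce (k + 1) h

/-- **The range of `ι` on `H¹_{F_𝔮}(K, T_𝔮)` IS `lim_k H¹_{F_𝔮}(K, T_𝔮/p^{k+1})`**: a family `y` over the shifted
tower lies in the typed `limitSelmer (k ↦ F_𝔮 at level k+1)` iff `y = (proj_{k+1} h)_k` for a (unique) `h` in the
pinned `H¹_{F_𝔮}(K, T_𝔮)` — extend `y` to level `0` by reduction, lift by `surj`, and level `0` is Selmer by
`map_eisensteinTwistReduce_mem_selmerGroup`. This is the clause `hι_range` of `nonempty_specWitness_of_dvrConclusion`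
for the honest module `H := I.selmerSubmodule F_𝔮 _`.
[cite: Howard2004HeegnerKolyvagin, §1.6 (arXiv p. 12, L29–55: H¹_F(K,T) = lim H¹_F(K,T/𝔪^k T)) and Def. 3.1.2] -/
theorem mem_limitSelmer_succ_iff_mem_range
    (y : letI := IwasawaAlgebra.isLocalRing_quotient_X_pow_add_C p hm
      ∀ k, galoisCohomology ((κ.eisensteinAdicTowerSucc ρ t hm ht).ρ k) 1) :
    letI := IwasawaAlgebra.isLocalRing_quotient_X_pow_add_C p hm
    y ∈ (κ.eisensteinAdicTowerSucc ρ t hm ht).limitSelmer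
        (fun k ↦ κ.eisensteinSelmerStructure ρ t hm S Φ (k + 1)) ↔
      y ∈ Set.range ((AddMonoidHom.pi (fun k ↦ I.proj (k + 1))).comp
        (I.selmerSubmodule (κ.eisensteinSelmerStructure ρ t hm S Φ)
          (fun k c x hx ↦ κ.map_eisensteinTwistSMulHom_mem_selmerGroup ρ t hm S Φ k c x hx)).subtype.toAddMonoidHom :
        ↥(I.selmerSubmodule (κ.eisensteinSelmerStructure ρ t hm S Φ)
          (fun k c x hx ↦ κ.map_eisensteinTwistSMulHom_mem_selmerGroup ρ t hm S Φ k c x hx)) →+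
          ∀ k, galoisCohomology ((κ.eisensteinAdicTowerSucc ρ t hm ht).ρ k) 1) := by
  letI := IwasawaAlgebra.isLocalRing_quotient_X_pow_add_C p hm
  constructor
  · intro hy
    rw [AdicTower.mem_limitSelmer_iff] at hy
    obtain ⟨hc, hsel⟩ := hy
    have hc' : ∀ k, galoisCohomology.map (κ.eisensteinTwistReduce hm (Nat.le_succ (k + 1)) (t (k + 1))) 1
        (y (k + 1)) = y k := fun k ↦ by
      rw [← κ.redH1_eisensteinAdicTowerSucc ρ t hm ht k]
      exact hc k
    -- extend the family to level `0` by reduction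
    let x : ∀ k, galoisCohomology (κ.eisensteinTwist (ρ k) hm k) 1 := fun k ↦
      Nat.casesOn k (galoisCohomology.map (κ.eisensteinTwistReduce hm (Nat.le_succ 0) (t 0)) 1 (y 0))
        fun j ↦ y j
    have hx : ∀ k, galoisCohomology.map (κ.eisensteinTwistReduce hm (Nat.le_succ k) (t k)) 1 (x (k + 1)) = x k := by
      intro k
      cases k with
      | zero => rfl
      | succ k => exact hc' k
    obtain ⟨h, hh⟩ := I.surj x hx
    have hmem : h ∈ I.selmerSubmodule (κ.eisensteinSelmerStructure ρ t hm S Φ)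
        (fun k c x hx ↦ κ.map_eisensteinTwistSMulHom_mem_selmerGroup ρ t hm S Φ k c x hx) := by
      rw [I.mem_selmerSubmodule_iff]
      intro k
      rw [hh k]
      cases k with
      | zero => exact κ.map_eisensteinTwistReduce_mem_selmerGroup ρ t hm S Φ 0 (hsel 0)
      | succ k => exact hsel k
    refine ⟨⟨h, hmem⟩, funext fun k ↦ ?_⟩
    exact hh (k + 1)
  · rintro ⟨h, rfl⟩
    exact I.projSucc_mem_limitSelmer_of_mem_ordinarySelmer ht S Φ h.2

end Selmer

end EisensteinH1Data

end ZpExtension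

/-! ## §4 Algebra: a free rank-one generator from `IsFreeRankOneOn` through the glue; the cokernel bound and the
non-vanishing of a control value from ONE non-divisible value -/

namespace IwasawaAlgebra

open Literature.NumberTheory.GaloisCohomology.Howard2004

section Generator

variable {K : Type} [Field K] {R : Type} [CommRing R] [IsLocalRing R]
  {N : ℕ → Type} [∀ k, AddCommGroup (N k)] [∀ k, TopologicalSpace (N k)] [∀ k, DiscreteTopology (N k)]
  [∀ k, Module R (N k)]

/-- **An honest generator from Thm. 1.6.1 (a).** If `lim_k H¹_F(K, T_k)` (`Sg`) is free of rank one over `R`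
with generator `x` (`AdicTower.IsFreeRankOneOn`) and `ι : H ↪ Π_k H¹(K, T_k)` is an `R`-compatible additive
injection with range `Sg`, then the preimage `x₀` of `x` generates `H` freely: `r ↦ r • x₀` is a bijection `R → H`
(the two bookkeeping steps `hsurj`/`hinj` of `nonempty_specWitness_of_dvrConclusion`, exported).
[cite: Howard2004HeegnerKolyvagin, Thm. 1.6.1 (a) (arXiv Thm. 2.6.1, p. 11, L25–26)] -/
theorem exists_bijective_toSpanSingleton_of_isFreeRankOneOn (T : AdicTower K R N)
    (Sg : AddSubgroup (∀ k, galoisCohomology (T.ρ k) 1)) (x : ∀ k, galoisCohomology (T.ρ k) 1)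
    (hfree : T.IsFreeRankOneOn Sg x)
    {H : Type*} [AddCommGroup H] [Module R H] (ι : H →+ (∀ k, galoisCohomology (T.ρ k) 1))
    (hι_inj : Function.Injective ι) (hι_range : ∀ y, y ∈ Sg ↔ y ∈ Set.range ι)
    (hι_smul : ∀ (r : R) (y : H), ι (r • y) = T.smulFamily r (ι y)) :
    ∃ x₀ : H, ι x₀ = x ∧ Function.Bijective (LinearMap.toSpanSingleton R H x₀) := by
  obtain ⟨hxmem, hann, hgen⟩ := hfree
  obtain ⟨x₀, hx₀⟩ : x ∈ Set.range ι := (hι_range x).mp hxmem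
  refine ⟨x₀, hx₀, ?_, ?_⟩
  · rw [injective_iff_map_eq_zero]
    intro r hr
    rw [LinearMap.toSpanSingleton_apply] at hr
    apply hann r
    rw [← hx₀, ← hι_smul, hr, map_zero]
  · intro y
    have hy : ι y ∈ Sg := (hι_range _).mpr ⟨y, rfl⟩
    obtain ⟨r, hr⟩ := hgen (ι y) hy
    refine ⟨r, hι_inj ?_⟩
    rw [LinearMap.toSpanSingleton_apply, hι_smul, hx₀, hr]

end Generator

section Cokernel

variable (p : ℕ) [hp : Fact p.Prime] {m : ℕ} (hm : 1 ≤ m)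
  [IsDomain (IwasawaAlgebra p ⧸
    Ideal.span {(PowerSeries.X ^ m + PowerSeries.C (p : ℤ_[p]) : IwasawaAlgebra p)})]
  [IsDiscreteValuationRing (IwasawaAlgebra p ⧸
    Ideal.span {(PowerSeries.X ^ m + PowerSeries.C (p : ℤ_[p]) : IwasawaAlgebra p)})]
  {H' : Type*} [AddCommGroup H'] [Module (IwasawaAlgebra p) H'] (N : Submodule (IwasawaAlgebra p) H')
  [Module (IwasawaAlgebra p ⧸
    Ideal.span {(PowerSeries.X ^ m + PowerSeries.C (p : ℤ_[p]) : IwasawaAlgebra p)}) N]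
  [IsScalarTower (IwasawaAlgebra p) (IwasawaAlgebra p ⧸
    Ideal.span {(PowerSeries.X ^ m + PowerSeries.C (p : ℤ_[p]) : IwasawaAlgebra p)}) N]
  (x₀ : N) (hx₀ : Function.Bijective (LinearMap.toSpanSingleton (IwasawaAlgebra p ⧸
    Ideal.span {(PowerSeries.X ^ m + PowerSeries.C (p : ℤ_[p]) : IwasawaAlgebra p)}) N x₀))

/-- Non-divisibility transfers to a submodule: if `y ∈ N` is not in `T^j • H'` then it is not in `T^j • N`.
[cite: AtiyahMacdonald1969, Ch. 2 (the submodule 𝔞M)] -/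
theorem not_mem_X_pow_smul_top_of_coe (y : N) {j : ℕ}
    (hy : (y : H') ∉ (Ideal.span {(PowerSeries.X : IwasawaAlgebra p) ^ j} • ⊤ : Submodule (IwasawaAlgebra p) H')) :
    y ∉ (Ideal.span {(PowerSeries.X : IwasawaAlgebra p) ^ j} • ⊤ : Submodule (IwasawaAlgebra p) N) := by
  intro hmem
  apply hy
  have h := Submodule.mem_map_of_mem (f := N.subtype) hmem
  rw [Submodule.map_smul''] at h
  exact Submodule.smul_mono le_rfl le_top h

include hm hx₀

/-- **The cokernel bound of a control map from ONE non-divisible value (co-restricted form).** Let `N ≤ H'` be a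
`Λ`-submodule which is a free rank-one `S_m`-module (`x₀`; Howard Thm. 1.6.1 (a) for `N = H¹_{F_𝔮}(K, T_𝔮)` inside
`H' = H¹(K, T_𝔮)`), `f : 𝔖 → H'` `Λ`-linear with `f(𝔖) ⊆ N`, and `e ∈ 𝔖` with `f e ∉ T^j • H'`, `j < m`. Then the
cokernel of the co-restriction `f̂ : 𝔖 → N` is finite of order `≤ p^j` — the inputs `hcoker`, `hcoker_le` of
`nonempty_specWitness_of_dvrConclusion`, UNIFORM in `m` as soon as `j` is.
[cite: Howard2004HeegnerKolyvagin, Thm. 1.6.1 (a), Prop. 2.2.8 and proof of Thm. 2.2.10 (𝔮 = T^m + p)]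
[cite: MazurRubinMemoirs2004, Prop. 5.3.14] -/
theorem finite_quotient_range_codRestrict_and_natCard_le {S : Type*} [AddCommGroup S]
    [Module (IwasawaAlgebra p) S] (f : S →ₗ[IwasawaAlgebra p] H') (hf : ∀ s, f s ∈ N) (e : S) {j : ℕ}
    (hjm : j < m)
    (he : f e ∉ (Ideal.span {(PowerSeries.X : IwasawaAlgebra p) ^ j} • ⊤ : Submodule (IwasawaAlgebra p) H')) :
    Finite (N ⧸ LinearMap.range (f.codRestrict N hf)) ∧
      Nat.card (N ⧸ LinearMap.range (f.codRestrict N hf)) ≤ p ^ j :=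
  finite_quotient_range_and_natCard_le_of_not_mem_X_pow_smul p hm x₀ hx₀ (f.codRestrict N hf) e hjm
    (not_mem_X_pow_smul_top_of_coe p N _ he)

omit hm
  [IsDiscreteValuationRing (IwasawaAlgebra p ⧸
    Ideal.span {(PowerSeries.X ^ m + PowerSeries.C (p : ℤ_[p]) : IwasawaAlgebra p)})] in
/-- **Non-vanishing of a control value.** In the situation of
`finite_quotient_range_codRestrict_and_natCard_le` (free rank-one `N` over the domain `S_m`, `f e ∉ T^j • H'`), if
`g • e ∈ Λ z` for some `g ∈ Λ` with `q_m ∤ g` (i.e. `[g] ≠ 0` in `S_m`), then `f z ≠ 0`: otherwise `[g] • f̂ e = 0` in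
`N ≅ S_m`, forcing `f̂ e = 0 ∈ T^j • N`. (For `𝔖 ⊇ Λz` with `𝔖/Λz` torsion this gives `f_m z ≠ 0`, i.e. the input
`hone` of `nonempty_specWitness_of_dvrConclusion_one`, for every `m` with `q_m ∤ g`.)
[cite: Howard2004HeegnerKolyvagin, proof of Thm. 2.2.10 (κ₁ generates an infinite S_𝔮-submodule for almost all 𝔮)] -/
theorem apply_ne_zero_of_smul_mem_span {S : Type*} [AddCommGroup S] [Module (IwasawaAlgebra p) S]
    (f : S →ₗ[IwasawaAlgebra p] H') (hf : ∀ s, f s ∈ N) (e : S) {j : ℕ}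
    (he : f e ∉ (Ideal.span {(PowerSeries.X : IwasawaAlgebra p) ^ j} • ⊤ : Submodule (IwasawaAlgebra p) H'))
    (z : S) (g : IwasawaAlgebra p)
    (hg : Ideal.Quotient.mk
      (Ideal.span {(PowerSeries.X ^ m + PowerSeries.C (p : ℤ_[p]) : IwasawaAlgebra p)}) g ≠ 0)
    (hge : g • e ∈ (IwasawaAlgebra p) ∙ z) : f z ≠ 0 := by
  intro hz
  obtain ⟨l, hl⟩ := Submodule.mem_span_singleton.1 hge
  -- `g • f e = 0` in `H'`, hence `[g] • f̂ e = 0` in `N`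
  have hge0 : g • f e = 0 := by rw [← map_smul, ← hl, map_smul, hz, smul_zero]
  have hN0 : (Ideal.Quotient.mk
      (Ideal.span {(PowerSeries.X ^ m + PowerSeries.C (p : ℤ_[p]) : IwasawaAlgebra p)}) g) •
        f.codRestrict N hf e = 0 := by
    rw [← smul_eq_mk_smul p]
    exact Subtype.ext (by rw [Submodule.coe_smul, LinearMap.codRestrict_apply, Submodule.coe_zero, hge0])
  -- in `N ≅ S_m` (a domain) this forces `f̂ e = 0`
  obtain ⟨r, hr⟩ := hx₀.2 (f.codRestrict N hf e)
  rw [LinearMap.toSpanSingleton_apply] at hr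
  have hgr : (Ideal.Quotient.mk
      (Ideal.span {(PowerSeries.X ^ m + PowerSeries.C (p : ℤ_[p]) : IwasawaAlgebra p)}) g) * r = 0 := by
    apply hx₀.1
    rw [LinearMap.toSpanSingleton_apply, LinearMap.toSpanSingleton_apply, mul_smul, hr, hN0]
    exact (zero_smul (IwasawaAlgebra p ⧸
      Ideal.span {(PowerSeries.X ^ m + PowerSeries.C (p : ℤ_[p]) : IwasawaAlgebra p)}) x₀).symm
  have hr0 : r = 0 := (mul_eq_zero.1 hgr).resolve_left hg
  have he0 : f.codRestrict N hf e = 0 := by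
    rw [← hr, hr0]
    exact zero_smul (IwasawaAlgebra p ⧸
      Ideal.span {(PowerSeries.X ^ m + PowerSeries.C (p : ℤ_[p]) : IwasawaAlgebra p)}) x₀
  apply he
  have : f e = 0 := by
    have := congrArg Subtype.val he0
    rwa [LinearMap.codRestrict_apply] at this
  rw [this]
  exact zero_mem _

end Cokernel

section Eventually

variable (p : ℕ) [hp : Fact p.Prime]

/-- **`q_m ∤ g` for all `m ≫ 0`** (`g ≠ 0`): a non-zero element of `Λ` is divisible by only finitely many of the
pairwise non-associate primes `q_m = T^m + p` (`finite_setOf_X_pow_add_C_dvd`), so its class in `S_m` is non-zero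
for every `m ≥ m₂`. [cite: Washington1997, §13.2 (Λ is a UFD)] [cite: Howard2004HeegnerKolyvagin, proof of Thm. 2.2.10 (all but finitely many height-one primes)] -/
theorem exists_forall_mk_ne_zero {g : IwasawaAlgebra p} (hg : g ≠ 0) :
    ∃ m₂ : ℕ, ∀ m, m₂ ≤ m →
      Ideal.Quotient.mk
        (Ideal.span {(PowerSeries.X ^ m + PowerSeries.C (p : ℤ_[p]) : IwasawaAlgebra p)}) g ≠ 0 := by
  obtain ⟨B, hB⟩ := (finite_setOf_X_pow_add_C_dvd p hg).bddAbove
  refine ⟨B + 1, fun m hm hzero ↦ ?_⟩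
  rw [Ideal.Quotient.eq_zero_iff_mem, Ideal.mem_span_singleton] at hzero
  have hmem : m ∈ {m : ℕ | 1 ≤ m ∧ (PowerSeries.X ^ m + PowerSeries.C (p : ℤ_[p]) : IwasawaAlgebra p) ∣ g} :=
    ⟨le_trans (Nat.le_add_left 1 B) hm, hzero⟩
  exact absurd (hB hmem) (by omega)

end Eventually

end IwasawaAlgebra

end Literature.NumberTheory.EllipticCurves

end
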